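import Literature.Probability.RandomPlanarGeometry.LoopConfigurations
import HarnessLib

/-!
# From DKKMO closeness of typed loop configurations to Hausdorff closeness of windowed based loop collections

Deterministic core of the bridge (layer N2 of the decomposition of `dkkmo_rotation_invariance`,
crit-perc.S25) between

* the *printed* closeness relation of Duminil-Copin–Kozlowski–Krachun–Manolescu–Oulamara,
  arXiv:2012.11672v2, §1.2 — `LoopConfig.IsClose ε F F'`: typed, unbased loops compared by the
  unoriented distance `d` of eq. (1) inside the soft window `B(0, 1/ε)` — and
* the conventions of the prelude's loop space used by crit-perc.S25 — *based oriented* loop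
  classes, every loop entered with all its base points, hard window `closedBall 0 R`, Hausdorff
  edistance of the resulting closed sets of `CurveClass E`.

A `TypedLoops E` is a typed family `S 0, S 1` of based oriented loop classes (think: all dart-based
classes `loopCurve δ α γ` of the interface loops `γ` of a percolation configuration, typed by
orientation); `TypedLoops.config` is the associated point of DKKMO's space `C` and
`TypedLoops.collection Λ` the windowed based collection (a point of `LoopSpace E`).
`TypedLoops.hausdorffEDist_collection_le` bounds the Hausdorff edistance between the windowed
collections of two families `T, T'` by `max (ε + θ) η`, given `IsClose ε T.config T'.config` and
four side conditions isolating exactly what percolation theory must supply with high probability: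

* `BoundaryRegular` — no loop of diameter `≥ r − 2ε` creeps along the window boundary from inside
  (inside `B(0, R + 2ε)` but not inside `closedBall 0 R`): a boundary three-arm event;
* `IsDense` — every point of the window is `η/2`-close to a whole small loop inside the window
  (microscopic loops are everywhere): RSW in independent annuli;
* `OrientedMatching` — for loops of diameter `≥ r` inside the window, `ε`-closeness of same-type
  loops in the unoriented distance `d` forces `ε`-closeness in the *oriented* unbased distance:
  winding numbers plus fatness of macroscopic loops (thin macroscopic loops are unlikely, DKKMO
  Lemma 3.10);
* `Rebasable` — the family contains, with a loop, base points fine enough that any based loop at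
  oriented unbased distance `d₀` from a member is at based distance `≤ d₀ + θ` from a member with
  the same trace (all darts are base points; `θ ≈` mesh).

Small loops (diameter `< r ≤ η/2`) are matched by density alone: two based loops whose traces lie
in a common ball of radius `η/2` are at based distance `≤ η` (`CurveClass.dist_le_diam_union`).

## References

* H. Duminil-Copin, K. K. Kozlowski, D. Krachun, I. Manolescu, M. Oulamara, arXiv:2012.11672v2
  (2026), §1.2 (the metric `d_CN`), §3.5 (Lemma 3.10, thin crossings; homotopy control).
* F. Camia, C. M. Newman, Comm. Math. Phys. 268 (2006), §2 (based curves, windows).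
-/

noncomputable section

open Set Metric
open scoped unitInterval ENNReal

namespace Literature.Probability.RandomPlanarGeometry

/-! ### Metric preliminaries on curve classes -/

namespace Curve

variable {E : Type*} [PseudoMetricSpace E]

/-- Two parametrised curves are at reparametrisation distance at most the diameter of the union
of their traces. [folklore] -/
theorem reparamDist_le_diam_union (γ₁ γ₂ : Curve E) :
    reparamDist γ₁ γ₂ ≤ Metric.diam (γ₁.range ∪ γ₂.range) := by
  refine (reparamDist_le_dist γ₁ γ₂).trans ((ContinuousMap.dist_le Metric.diam_nonneg).2 fun t ↦ ?_)
  have hb : Bornology.IsBounded (γ₁.range ∪ γ₂.range) :=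
    (γ₁.isCompact_range.union γ₂.isCompact_range).isBounded
  exact Metric.dist_le_diam_of_mem hb (Or.inl ⟨t, rfl⟩) (Or.inr ⟨t, rfl⟩)

end Curve

namespace CurveClass

variable {E : Type*} [MetricSpace E]

/-- Two curve classes are at (based) distance at most the diameter of the union of their traces:
loops inside a common small ball are close whatever their shapes. [folklore] -/
theorem dist_le_diam_union (c₁ c₂ : CurveClass E) : dist c₁ c₂ ≤ Metric.diam (c₁.range ∪ c₂.range) := by
  obtain ⟨γ₁, rfl⟩ := surjective_mk c₁
  obtain ⟨γ₂, rfl⟩ := surjective_mk c₂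
  rw [dist_mk_mk, range_mk, range_mk]
  exact Curve.reparamDist_le_diam_union γ₁ γ₂

end CurveClass

namespace UnbasedLoop

variable {E : Type*} [MetricSpace E]

/-- The trace of the unbased loop of a loop class. [folklore] -/
@[simp] theorem range_mk_mk (c : CurveClass E) (hc : c.IsLoop) :
    (mk (BasedLoop.mk c hc)).range = c.range := rfl

/-- Traces of `d`-close loops have close diameters: `diam u ≤ diam v + 2 d(u, v)`. [folklore] -/
theorem diam_range_le_add (u v : UnbasedLoop E) :
    Metric.diam u.range ≤ Metric.diam v.range + 2 * udist u v := by
  refine Metric.diam_le_of_forall_dist_le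
    (add_nonneg Metric.diam_nonneg (mul_nonneg zero_le_two (udist_nonneg u v))) fun x hx y hy ↦ ?_
  obtain ⟨x', hx', hxx'⟩ := exists_mem_range_dist_le u v hx
  obtain ⟨y', hy', hyy'⟩ := exists_mem_range_dist_le u v hy
  calc dist x y ≤ dist x x' + dist x' y' + dist y' y := dist_triangle4 x x' y' y
    _ ≤ udist u v + Metric.diam v.range + udist u v := by
        gcongr
        · exact Metric.dist_le_diam_of_mem v.isCompact_range.isBounded hx' hy'
        · rwa [dist_comm]
    _ = Metric.diam v.range + 2 * udist u v := by ring

end UnbasedLoop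

/-! ### Typed families of based loops -/

/-- A **typed family of based oriented loop classes**: two sets `S 0`, `S 1` of loop classes
(e.g. all dart-based classes of the interface loops of a percolation configuration, typed by
orientation = DKKMO's `F₀`/`F₁` typing, arXiv:2012.11672v2, §1.2). [cite: arXiv201211672v2, §1.2] -/
structure TypedLoops (E : Type*) [MetricSpace E] where
  /-- the based loop classes of type `i` -/
  S : Fin 2 → Set (CurveClass E)
  /-- every member is a loop -/
  isLoop : ∀ i, ∀ c ∈ S i, c.IsLoop

namespace TypedLoops

variable {E : Type*} [NormedAddCommGroup E]

/-- All members, both types together. [folklore] -/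
def all (T : TypedLoops E) : Set (CurveClass E) := ⋃ i, T.S i

/-- Membership in `all`. [folklore] -/
theorem mem_all {T : TypedLoops E} {c : CurveClass E} : c ∈ T.all ↔ ∃ i, c ∈ T.S i := mem_iUnion

/-- The point of DKKMO's space `C` defined by a typed family: forget base points (and compare
unoriented). [cite: arXiv201211672v2, §1.2] -/
def config (T : TypedLoops E) : LoopConfig E where
  F i := {u | ∃ (c : CurveClass E) (h : c ∈ T.S i), u = UnbasedLoop.mk (BasedLoop.mk c (T.isLoop i c h))}

/-- Members give members of the configuration. [folklore] -/
theorem mk_mem_config {T : TypedLoops E} {i : Fin 2} {c : CurveClass E} (h : c ∈ T.S i) :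
    UnbasedLoop.mk (BasedLoop.mk c (T.isLoop i c h)) ∈ T.config.F i := ⟨c, h, rfl⟩

/-- The members whose trace lies in the window `Λ` (hard window, as in crit-perc.S25). [folklore] -/
def window (T : TypedLoops E) (Λ : Set E) : Set (CurveClass E) := {c ∈ T.all | c.range ⊆ Λ}

/-- Membership in the window. [folklore] -/
theorem mem_window {T : TypedLoops E} {Λ : Set E} {c : CurveClass E} :
    c ∈ T.window Λ ↔ c ∈ T.all ∧ c.range ⊆ Λ := Iff.rfl

/-- The windowed based collection as a point of the loop space (closure of `window`; the closure
is vacuous for the finite families of percolation in a bounded window). [folklore] -/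
def collection (T : TypedLoops E) (Λ : Set E) : LoopSpace E := ⟨closure (T.window Λ), isClosed_closure⟩

/-- The underlying closed set of `collection`. [folklore] -/
@[simp] theorem coe_collection (T : TypedLoops E) (Λ : Set E) :
    (T.collection Λ : Set (CurveClass E)) = closure (T.window Λ) := rfl

/-! ### The four side conditions -/

/-- **Boundary regularity** at radius `R`, tolerance `ε`, scale `r`: a member of diameter `≥ r`
lying inside `B(0, R + 2ε)` already lies inside `closedBall 0 R` (no macroscopic loop creeps along
the window boundary from inside). [folklore] -/
def BoundaryRegular (T : TypedLoops E) (R ε r : ℝ) : Prop :=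
  ∀ c ∈ T.all, r ≤ Metric.diam c.range → c.range ⊆ Metric.ball (0 : E) (R + 2 * ε) →
    c.range ⊆ Metric.closedBall (0 : E) R

/-- **Density of small loops** in the window `Λ` at scale `η`: every point of `Λ` is within `η` of
a whole member lying inside `Λ ∩ closedBall x η`. [folklore] -/
def IsDense (T : TypedLoops E) (Λ : Set E) (η : ℝ) : Prop :=
  ∀ x ∈ Λ, ∃ c ∈ T.all, c.range ⊆ Λ ∧ c.range ⊆ Metric.closedBall x η

/-- **Oriented matching** from `T` to `T'` in the window `Λ` above scale `r` at tolerance `ε`: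
for same-type members `c ∈ T.S i` inside `Λ` and `c' ∈ T'.S i` with `diam c ≥ r`, closeness
`≤ ε` in DKKMO's unoriented unbased distance `d` forces closeness `≤ ε` in the oriented unbased
distance `CurveClass.loopDist` (fat loops: the type pins the orientation). [folklore] -/
def OrientedMatching (T T' : TypedLoops E) (Λ : Set E) (r ε : ℝ) : Prop :=
  ∀ i, ∀ (c : CurveClass E) (h : c ∈ T.S i) (c' : CurveClass E) (h' : c' ∈ T'.S i),
    c.range ⊆ Λ → r ≤ Metric.diam c.range →
    (UnbasedLoop.mk (BasedLoop.mk c (T.isLoop i c h))).udist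
        (UnbasedLoop.mk (BasedLoop.mk c' (T'.isLoop i c' h'))) ≤ ε →
      CurveClass.loopDist c c' ≤ ε

/-- **Rebasability** of `T'` with slack `θ`: for every based loop `c` and member `c' ∈ T'.S i`
there is a member `c'' ∈ T'.S i` with the same trace as `c'` at based distance
`≤ loopDist c c' + θ` from `c` (all darts are base points, consecutive ones `θ`-close). [folklore] -/
def Rebasable (T' : TypedLoops E) (θ : ℝ) : Prop :=
  ∀ (c : CurveClass E) (i : Fin 2), ∀ c' ∈ T'.S i, ∃ c'' ∈ T'.S i,
    c''.range = c'.range ∧ dist c c'' ≤ CurveClass.loopDist c c' + θ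

/-! ### The matching theorem -/

/-- **One-sided matching.** Under `IsClose ε`, boundary regularity and rebasability of `T'`,
density of `T'` in the window and oriented matching from `T` to `T'`, every member of `T` inside
`closedBall 0 R` has a member of `T'` inside `closedBall 0 R` at based distance
`≤ max (ε + θ) η`. Scales: `0 < ε`, `2ε < r ≤ η/2`, `R + 2ε ≤ 1/ε`. [folklore] -/
theorem exists_mem_window_dist_le {T T' : TypedLoops E} {R ε r η θ : ℝ} (hε : 0 < ε)
    (hr : r ≤ η / 2) (hR : R + 2 * ε ≤ 1 / ε) (hclose : LoopConfig.IsClose ε T.config T'.config)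
    (hB : T'.BoundaryRegular R ε (r - 2 * ε)) (hD : T'.IsDense (Metric.closedBall 0 R) (η / 2))
    (hO : OrientedMatching T T' (Metric.closedBall 0 R) r ε) (hRb : T'.Rebasable θ)
    {c : CurveClass E} (hc : c ∈ T.window (Metric.closedBall 0 R)) :
    ∃ c'' ∈ T'.window (Metric.closedBall 0 R), dist c c'' ≤ max (ε + θ) η := by
  obtain ⟨hcall, hcR⟩ := hc
  obtain ⟨i, hci⟩ := mem_all.1 hcall
  by_cases hsmall : Metric.diam c.range < r
  · -- small loops: density alone
    obtain ⟨x, hx⟩ := c.range_nonempty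
    obtain ⟨c', hc'all, hc'R, hc'x⟩ := hD x (hcR hx)
    refine ⟨c', ⟨hc'all, hc'R⟩, le_max_of_le_right ?_⟩
    have hcx : c.range ⊆ Metric.closedBall x (η / 2) := fun y hy ↦ by
      rw [Metric.mem_closedBall]
      exact (Metric.dist_le_diam_of_mem c.isCompact_range.isBounded hy hx).trans (by linarith)
    calc dist c c' ≤ Metric.diam (c.range ∪ c'.range) := CurveClass.dist_le_diam_union c c'
      _ ≤ Metric.diam (Metric.closedBall x (η / 2)) :=
          Metric.diam_mono (union_subset hcx hc'x) Metric.isBounded_closedBall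
      _ ≤ 2 * (η / 2) := Metric.diam_closedBall (by linarith [Metric.diam_nonneg (s := c.range)])
      _ = η := by ring
  · -- large loops: DKKMO matching, orientation, rebasing, boundary regularity
    replace hsmall : r ≤ Metric.diam c.range := not_lt.1 hsmall
    set u : UnbasedLoop E := UnbasedLoop.mk (BasedLoop.mk c (T.isLoop i c hci)) with hu
    have hwin : u.range ⊆ Metric.ball (0 : E) (1 / ε) := by
      rw [hu, UnbasedLoop.range_mk_mk]
      exact hcR.trans (Metric.closedBall_subset_ball (by nlinarith))
    obtain ⟨u', hu', hd⟩ := (hclose i).1 u (mk_mem_config hci) hwin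
    obtain ⟨c', hc'i, rfl⟩ := hu'
    -- oriented unbased closeness
    have hod : CurveClass.loopDist c c' ≤ ε := hO i c hci c' hc'i hcR hsmall hd
    -- rebase
    obtain ⟨c'', hc''i, hrange, hdist⟩ := hRb c i c' hc'i
    -- the partner's trace: inside `B(0, R + 2ε)`, diameter `≥ r - 2ε`, hence inside the window
    have hc'ball : c'.range ⊆ Metric.ball (0 : E) (R + 2 * ε) := by
      have h1 : u.range ⊆ Metric.ball (0 : E) (R + ε) := by
        rw [hu, UnbasedLoop.range_mk_mk]
        exact hcR.trans (Metric.closedBall_subset_ball (by linarith))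
      have h2 := UnbasedLoop.range_subset_ball_of_udist_le h1 hd
      rw [UnbasedLoop.range_mk_mk] at h2
      convert h2 using 2; ring
    have hc'diam : r - 2 * ε ≤ Metric.diam c'.range := by
      have h := UnbasedLoop.diam_range_le_add u (UnbasedLoop.mk (BasedLoop.mk c' (T'.isLoop i c' hc'i)))
      rw [hu, UnbasedLoop.range_mk_mk, UnbasedLoop.range_mk_mk] at h
      linarith
    have hc'R : c'.range ⊆ Metric.closedBall (0 : E) R :=
      hB c' (mem_all.2 ⟨i, hc'i⟩) hc'diam hc'ball
    refine ⟨c'', ⟨mem_all.2 ⟨i, hc''i⟩, hrange ▸ hc'R⟩, le_max_of_le_left ?_⟩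
    exact hdist.trans (by linarith)

/-- **From `d_CN ≤ ε` to the Hausdorff edistance of windowed based collections.** If the typed
configurations of `T` and `T'` satisfy the printed relation `d_CN ≤ ε` (DKKMO §1.2) and both
families are boundary regular, dense in the window, rebasable, and admit oriented matchings in
both directions, then their windowed based collections (crit-perc.S25 conventions) are at
Hausdorff edistance `≤ max (ε + θ) η`. The four side conditions are what percolation estimates
(boundary three-arm bound, RSW density of small loops, DKKMO's Lemma 3.10 on thin loops together
with winding numbers, and the all-darts base-point convention) provide with high probability. [cite: arXiv201211672v2, §1.2] -/
theorem hausdorffEDist_collection_le {T T' : TypedLoops E} {R ε r η θ : ℝ} (hε : 0 < ε)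
    (hr : r ≤ η / 2) (hR : R + 2 * ε ≤ 1 / ε) (hclose : LoopConfig.IsClose ε T.config T'.config)
    (hB : T.BoundaryRegular R ε (r - 2 * ε)) (hB' : T'.BoundaryRegular R ε (r - 2 * ε))
    (hD : T.IsDense (Metric.closedBall 0 R) (η / 2)) (hD' : T'.IsDense (Metric.closedBall 0 R) (η / 2))
    (hO : OrientedMatching T T' (Metric.closedBall 0 R) r ε)
    (hO' : OrientedMatching T' T (Metric.closedBall 0 R) r ε)
    (hRb : T.Rebasable θ) (hRb' : T'.Rebasable θ) :
    edist (T.collection (Metric.closedBall 0 R)) (T'.collection (Metric.closedBall 0 R)) ≤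
      ENNReal.ofReal (max (ε + θ) η) := by
  rw [TopologicalSpace.Closeds.edist_eq, coe_collection, coe_collection,
    hausdorffEDist_closure_left, hausdorffEDist_closure_right]
  refine hausdorffEDist_le_of_mem_edist ?_ ?_
  · intro c hc
    obtain ⟨c'', hc'', hd⟩ := exists_mem_window_dist_le hε hr hR hclose hB' hD' hO hRb' hc
    exact ⟨c'', hc'', by rw [edist_dist]; exact ENNReal.ofReal_le_ofReal hd⟩
  · intro c' hc'
    obtain ⟨c'', hc'', hd⟩ := exists_mem_window_dist_le hε hr hR hclose.symm hB hD hO' hRb hc'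
    exact ⟨c'', hc'', by rw [edist_dist]; exact ENNReal.ofReal_le_ofReal hd⟩

end TypedLoops

end Literature.Probability.RandomPlanarGeometry

end
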